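import Summits.BirchSwinnertonDyer.Rank1Residual.X11b.CastellaErratumTwist
import Summits.BirchSwinnertonDyer.Rank1Residual.X11b.TwistTransportRam
import Literature.NumberTheory.EllipticCurves.KramerDescentLocalGeneratorsProofs
import Literature.NumberTheory.EllipticCurves.ComplexMultiplicationDeuringFrobeniusProofs
import Literature.NumberTheory.EllipticCurves.GlobalMinimalModel
import HarnessLib

/-!
# Route `CyclotomicUntwist`: the principal-series row predicate `Δ_min ∈ (ℚ₃^×)²` — its `3`-adic reading and
# its STABILITY under quadratic twists by `3`-adic squares (in particular under the Heegner twist `E ↦ E^{(d_K)}`)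

Cell `bsd-wall` (W-ALL, row 2 @3), prover seat `bsd-line-cycu-p3` (g0), 2026-08-27. ROUTE-FREE (imports no
`Theses.*`): elementary `3`-adic bookkeeping, kernel-checked; 0 definitions, 0 named facts, 0 `sorry`; BSD is
not advanced by this.

Route `CyclotomicUntwist` cuts its principal-series (PS) rows out of the onto wild rank-one leaf at `3` by the
census-decidable predicate, written verbatim in its cruxes `PSRankOneLowerHalfAtThree` /
`PSRankOneUpperHalfAtThree`,

  `Even (padicValInt 3 W.minimalDiscriminantInt) ∧
     W.minimalDiscriminantInt / 3 ^ padicValInt 3 W.minimalDiscriminantInt % 3 = 1`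

(«`v₃(Δ_min)` even and `Δ_min/3^v ≡ 1 (mod 3)`, equivalently `Δ_min ∈ (ℚ₃^×)²`», route text). This file proves
the equivalence and the one structural fact every Heegner-point road on these rows needs:

* §1 `isSquare_padic_minimalDiscriminantInt_iff_ps` — for a globally minimal elliptic `W/ℚ`:
  `IsSquare (Δ_min : ℚ₃) ↔` the PS predicate (Hensel at the odd prime `3`: `3^{2k}·n` with `n ≢ 0` a square
  mod `3` is a `3`-adic square, tree `KramerLocal.padic_isSquare_pow_mul`; conversely a `3`-adic square has even
  valuation and unit part a square mod `3`, i.e. `≡ 1`, tree `DeuringLadic.isSquare_zmod_of_isSquare_padic`).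
* §2 `isSquare_padic_minimalDiscriminantInt_iff_of_twist`, **`ps_iff_of_twist`** — for globally minimal `W`,
  `Wd` with `Cd • W^{(d)} = Wd` and `d ∈ (ℚ₃^×)²`: `W` is a PS row iff `Wd` is. (`W ⊗ ℚ₃ ≅ Wd ⊗ ℚ₃`, tree
  `X11b.exists_baseChange_eq_smul_of_twist`, so `Δ_min(Wd) = u^{-12}·Δ_min(W)` in `ℚ₃`, a square factor.)
* §3 **`ps_iff_of_heegner_twist`** — the case `d = d_K` for an imaginary quadratic Heegner field `K` of `N(E)`
  with `3 ∣ N(E)` (so `3` splits in `K` and `d_K ∈ (ℚ₃^×)²`, tree `X11b.isSquare_discr_padic_of_heegner`): the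
  globally minimal model of the Heegner twist of a PS row is a PS row, and of a supercuspidal row a
  supercuspidal row. Use: the rank-zero partner `E^{(d_K)}` that the Gross–Zagier bookkeeping of the onto wild
  leaf consumes (`WildRankZeroTwistAtThree`) can be asked for on the PS rows ONLY when `E` is a PS row — the
  route's finite-slope road applies to the partner as well (same untwist `g ⊗ χ_{d_K}`).

References: [Serre1973] Ch. II §3.3 Thm 3 (squares in `ℚ_p`, `p` odd); [SilvermanAEC2009] VII.1 Prop. 1.3(b),
X.§5 (quadratic twists); [GrossZagier1986] V.§2 (the twist `E^{(D)}` over a Heegner field).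
-/

noncomputable section

open scoped Classical

set_option linter.dupNamespace false
set_option autoImplicit false

namespace Summit.BirchSwinnertonDyer.BirchSwinnertonDyer.Theorems.CyclotomicUntwistPS

open WeierstrassCurve Literature.NumberTheory.EllipticCurves Summit.BirchSwinnertonDyer.Rank1Residual

/-! ### §0 Squares modulo `3` and square factors -/

/-- In `ℤ/3ℤ` the only non-zero square is `1`. [folklore] -/
theorem zmod_three_eq_one_of_isSquare_of_ne_zero (x : ZMod 3) (h0 : x ≠ 0) (hsq : IsSquare x) : x = 1 := by
  obtain ⟨r, hr⟩ := hsq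
  subst hr
  revert h0
  revert r
  decide

/-- For an integer `n`: `(n : ℤ/3ℤ) = 1 ↔ n % 3 = 1`. [folklore] -/
theorem intCast_zmod_three_eq_one_iff (n : ℤ) : ((n : ℤ) : ZMod 3) = 1 ↔ n % 3 = 1 := by
  constructor
  · intro h
    have h' : ((n : ℤ) : ZMod 3) = ((1 : ℤ) : ZMod 3) := by rw [h, Int.cast_one]
    rw [ZMod.intCast_eq_intCast_iff_dvd_sub] at h'
    omega
  · intro h
    have : (((n % (3 : ℕ) : ℤ)) : ZMod 3) = ((n : ℤ) : ZMod 3) := ZMod.intCast_mod n 3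
    rw [← this]
    have h3 : n % ((3 : ℕ) : ℤ) = 1 := by exact_mod_cast h
    rw [h3, Int.cast_one]

/-- Multiplying by a non-zero square does not change squareness (in a field). [folklore] -/
theorem isSquare_mul_iff_of_isSquare_of_ne_zero {F : Type} [Field F] {c x : F} (hc : IsSquare c)
    (hc0 : c ≠ 0) : IsSquare (c * x) ↔ IsSquare x := by
  obtain ⟨t, ht⟩ := hc
  have ht0 : t ≠ 0 := by rintro rfl; exact hc0 (by rw [ht, mul_zero])
  constructor
  · rintro ⟨s, hs⟩
    refine ⟨s / t, ?_⟩
    have : x = c * x / c := by field_simp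
    rw [this, hs, ht]
    field_simp
  · rintro ⟨r, hr⟩
    exact ⟨t * r, by rw [hr, ht]; ring⟩

/-! ### §1 The PS predicate is `Δ_min ∈ (ℚ₃^×)²` -/

/-- **`Δ_min` is a `3`-adic square iff `v₃(Δ_min)` is even and `Δ_min/3^{v} ≡ 1 (mod 3)`** (globally minimal
elliptic `W/ℚ`; `/` and `%` are integer division and remainder, as in route `CyclotomicUntwist`'s cruxes).
(⇐) Hensel at the odd prime `3` (`KramerLocal.padic_isSquare_pow_mul`). (⇒) the valuation of a square is even
(`Padic.valuation_mul`, `Padic.valuation_intCast`), and the unit part `n = Δ_min/3^{2k} = (y/3^k)²` is a `3`-adic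
square, hence a square mod `3` (`DeuringLadic.isSquare_zmod_of_isSquare_padic`), non-zero mod `3` by maximality of
the valuation, hence `≡ 1`. [cite: Serre1973, Ch. II §3.3 Thm 3] -/
theorem isSquare_padic_minimalDiscriminantInt_iff_ps (W : WeierstrassCurve ℚ) [W.IsElliptic]
    [W.IsGloballyMinimal] :
    IsSquare ((W.minimalDiscriminantInt : ℤ) : ℚ_[3]) ↔
      (Even (padicValInt 3 W.minimalDiscriminantInt) ∧
        W.minimalDiscriminantInt / 3 ^ padicValInt 3 W.minimalDiscriminantInt % 3 = 1) := by
  set Δ : ℤ := W.minimalDiscriminantInt with hΔdef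
  set v : ℕ := padicValInt 3 Δ with hvdef
  have hΔ0 : Δ ≠ 0 := minimalDiscriminantInt_ne_zero W
  -- `Δ = 3^v · n` with `n = Δ / 3^v` not divisible by `3`
  have hdvd : (3 : ℤ) ^ v ∣ Δ := by exact_mod_cast padicValInt_dvd (p := 3) Δ
  set n : ℤ := Δ / 3 ^ v with hndef
  have hΔn : Δ = 3 ^ v * n := (Int.mul_ediv_cancel' hdvd).symm
  have hn3 : ¬ (3 : ℤ) ∣ n := by
    intro h
    have h' : ((3 : ℕ) : ℤ) ^ (v + 1) ∣ Δ := by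
      rw [hΔn, pow_succ]
      exact_mod_cast mul_dvd_mul_left ((3 : ℤ) ^ v) h
    rcases (padicValInt_dvd_iff (p := 3) (v + 1) Δ).mp h' with h0 | hle
    · exact hΔ0 h0
    · simp [hvdef] at hle
  have hnz : ((n : ℤ) : ZMod 3) ≠ 0 := by
    rw [Ne, ZMod.intCast_zmod_eq_zero_iff_dvd]
    exact_mod_cast hn3
  constructor
  · -- (⇒)
    rintro ⟨y, hy⟩
    have hΔq0 : ((Δ : ℤ) : ℚ_[3]) ≠ 0 := by exact_mod_cast hΔ0
    have hy0 : y ≠ 0 := by rintro rfl; exact hΔq0 (by rw [hy, mul_zero])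
    -- even valuation
    have hval : (v : ℤ) = y.valuation + y.valuation := by
      have h1 : ((Δ : ℤ) : ℚ_[3]).valuation = (padicValInt 3 Δ : ℤ) := Padic.valuation_intCast Δ
      rw [hy, Padic.valuation_mul hy0 hy0] at h1
      exact_mod_cast h1.symm
    have heven : Even v := by
      have : Even (v : ℤ) := ⟨y.valuation, hval⟩
      exact (Int.even_coe_nat v).mp this
    refine ⟨heven, ?_⟩
    obtain ⟨k, hk⟩ := heven
    -- the unit part is a `3`-adic square
    have hnsq : IsSquare ((n : ℤ) : ℚ_[3]) := by
      have h3 : ((3 : ℤ) : ℚ_[3]) ≠ 0 := by exact_mod_cast (by norm_num : (3 : ℤ) ≠ 0)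
      have hpow : (((3 : ℤ) ^ v : ℤ) : ℚ_[3]) ≠ 0 := by push_cast; exact pow_ne_zero _ h3
      have hnq : ((n : ℤ) : ℚ_[3]) = ((Δ : ℤ) : ℚ_[3]) / (((3 : ℤ) ^ v : ℤ) : ℚ_[3]) := by
        rw [eq_div_iff hpow, hΔn]; push_cast; ring
      refine ⟨y / ((3 : ℤ) : ℚ_[3]) ^ k, ?_⟩
      rw [hnq, hy, hk]; push_cast; field_simp; ring
    have hz : IsSquare ((n : ℤ) : ZMod 3) := DeuringLadic.isSquare_zmod_of_isSquare_padic hnsq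
    exact (intCast_zmod_three_eq_one_iff n).mp (zmod_three_eq_one_of_isSquare_of_ne_zero _ hnz hz)
  · -- (⇐)
    rintro ⟨heven, hmod⟩
    obtain ⟨k, hk⟩ := heven
    have h1 : ((n : ℤ) : ZMod 3) = 1 := (intCast_zmod_three_eq_one_iff n).mpr hmod
    have hsq : IsSquare ((n : ℤ) : ZMod 3) := ⟨1, by rw [h1, mul_one]⟩
    have key := KramerLocal.padic_isSquare_pow_mul (p := 3) (by decide) k hnz hsq
    have hΔ' : Δ = (3 : ℤ) ^ (2 * k) * n := by rw [hΔn, hk, two_mul]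
    have : (((3 : ℕ) : ℤ) ^ (2 * k) * n : ℤ) = Δ := by push_cast; exact hΔ'.symm
    rwa [this] at key

/-! ### §2 Stability under twists by `3`-adic squares -/

/-- **`Δ_min ∈ (ℚ₃^×)²` transports along a twist by a `3`-adic square.** For globally minimal elliptic `W`, `Wd`
over `ℚ` with `Cd • W^{(d)} = Wd`, `d ≠ 0` a square in `ℚ₃`: `W ⊗ ℚ₃` and `Wd ⊗ ℚ₃` are `ℚ₃`-isomorphic
(`X11b.exists_baseChange_eq_smul_of_twist`), so `Δ_min(Wd) = u^{-12}·Δ_min(W)` in `ℚ₃`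
(`variableChange_Δ`, `cast_minimalDiscriminantInt`), and `u^{-12} = (u^{-6})²`.
[cite: SilvermanAEC2009, VII.1 Prop. 1.3(b) and X.§5] -/
theorem isSquare_padic_minimalDiscriminantInt_iff_of_twist (W : WeierstrassCurve ℚ) [W.IsElliptic]
    [W.IsGloballyMinimal] {d : ℚ} (hd : d ≠ 0) (hsq : IsSquare ((d : ℚ) : ℚ_[3]))
    (Wd : WeierstrassCurve ℚ) [Wd.IsElliptic] [Wd.IsGloballyMinimal] {Cd : VariableChange ℚ}
    (hWd : Cd • W.quadraticTwist d = Wd) :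
    IsSquare ((Wd.minimalDiscriminantInt : ℤ) : ℚ_[3]) ↔ IsSquare ((W.minimalDiscriminantInt : ℤ) : ℚ_[3]) := by
  obtain ⟨D, hD⟩ := X11b.exists_baseChange_eq_smul_of_twist (W := W) hd hsq Wd hWd
  have hX : (W.baseChange ℚ_[3]).Δ = ((W.minimalDiscriminantInt : ℤ) : ℚ_[3]) := by
    rw [baseChange, map_Δ, ← cast_minimalDiscriminantInt W, map_intCast]
  have hY : (Wd.baseChange ℚ_[3]).Δ = ((Wd.minimalDiscriminantInt : ℤ) : ℚ_[3]) := by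
    rw [baseChange, map_Δ, ← cast_minimalDiscriminantInt Wd, map_intCast]
  have hrel : ((Wd.minimalDiscriminantInt : ℤ) : ℚ_[3]) =
      ((D.u⁻¹ : ℚ_[3]ˣ) : ℚ_[3]) ^ 12 * ((W.minimalDiscriminantInt : ℤ) : ℚ_[3]) := by
    rw [← hY, ← hX, hD, variableChange_Δ]
  rw [hrel]
  refine isSquare_mul_iff_of_isSquare_of_ne_zero ⟨((D.u⁻¹ : ℚ_[3]ˣ) : ℚ_[3]) ^ 6, by ring⟩ ?_
  exact pow_ne_zero _ (Units.ne_zero _)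

/-- **A twist by a `3`-adic square of a PS row is a PS row, and of a non-PS row a non-PS row** (the
predicate of route `CyclotomicUntwist`, verbatim). [cite: SilvermanAEC2009, VII.1 Prop. 1.3(b) and X.§5]
[cite: Serre1973, Ch. II §3.3 Thm 3] -/
theorem ps_iff_of_twist (W : WeierstrassCurve ℚ) [W.IsElliptic] [W.IsGloballyMinimal] {d : ℚ} (hd : d ≠ 0)
    (hsq : IsSquare ((d : ℚ) : ℚ_[3])) (Wd : WeierstrassCurve ℚ) [Wd.IsElliptic] [Wd.IsGloballyMinimal]
    {Cd : VariableChange ℚ} (hWd : Cd • W.quadraticTwist d = Wd) :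
    (Even (padicValInt 3 Wd.minimalDiscriminantInt) ∧
        Wd.minimalDiscriminantInt / 3 ^ padicValInt 3 Wd.minimalDiscriminantInt % 3 = 1) ↔
      (Even (padicValInt 3 W.minimalDiscriminantInt) ∧
        W.minimalDiscriminantInt / 3 ^ padicValInt 3 W.minimalDiscriminantInt % 3 = 1) := by
  rw [← isSquare_padic_minimalDiscriminantInt_iff_ps W, ← isSquare_padic_minimalDiscriminantInt_iff_ps Wd]
  exact isSquare_padic_minimalDiscriminantInt_iff_of_twist W hd hsq Wd hWd

/-! ### §3 The Heegner twist -/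

/-- **The globally minimal model of the Heegner twist `E^{(d_K)}` of a PS row is a PS row (and of a
supercuspidal row a supercuspidal row).** For `W` globally minimal elliptic with `3 ∣ N(E)`, `K` imaginary
quadratic with the Heegner hypothesis for `N(E)` (so `3` splits in `K` and `d_K ∈ (ℚ₃^×)²`,
`X11b.isSquare_discr_padic_of_heegner`), and `Cd • W^{(d_K)} = Wd` globally minimal: the PS predicate of
route `CyclotomicUntwist` holds for `Wd` iff it holds for `W`. [cite: GrossZagier1986, V.§2 (the twist over a Heegner field)]
[cite: Serre1973, Ch. II §3.3 Thm 3] -/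
theorem ps_iff_of_heegner_twist (W : WeierstrassCurve ℚ) [W.IsElliptic] [W.IsGloballyMinimal]
    (h3N : 3 ∣ W.conductorNorm ℤ) (K : Type) [Field K] [NumberField K] (hK : IsImaginaryQuadratic K)
    (hHN : SatisfiesHeegnerHypothesis (W.conductorNorm ℤ) K)
    (Wd : WeierstrassCurve ℚ) [Wd.IsElliptic] [Wd.IsGloballyMinimal] {Cd : VariableChange ℚ}
    (hWd : Cd • W.quadraticTwist (NumberField.discr K : ℚ) = Wd) :
    (Even (padicValInt 3 Wd.minimalDiscriminantInt) ∧
        Wd.minimalDiscriminantInt / 3 ^ padicValInt 3 Wd.minimalDiscriminantInt % 3 = 1) ↔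
      (Even (padicValInt 3 W.minimalDiscriminantInt) ∧
        W.minimalDiscriminantInt / 3 ^ padicValInt 3 W.minimalDiscriminantInt % 3 = 1) := by
  have hD0 : (NumberField.discr K : ℚ) ≠ 0 := by exact_mod_cast NumberField.discr_ne_zero K
  have hsq' : IsSquare (algebraMap ℚ ℚ_[3] (NumberField.discr K : ℚ)) :=
    X11b.isSquare_discr_padic_of_heegner K hK hHN 3 h3N
  have hsq : IsSquare (((NumberField.discr K : ℚ) : ℚ) : ℚ_[3]) := by simpa using hsq'
  exact ps_iff_of_twist W hD0 hsq Wd hWd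

end Summit.BirchSwinnertonDyer.BirchSwinnertonDyer.Theorems.CyclotomicUntwistPS

end
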